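import Summits.HubbardSuperconductivity.HubbardSuperconductivity.Theorems.CooperPairDMottWalkCooperPairDMottTwoHoleGapBlocks
import Literature.Probability.LatticeModels.TorusFourierProofs

/-!
# Route `CooperPairDMottWalk`, crux `CooperPairDMott` (stmt-HubbardSuperconductivity-1177):
# plaquette-momentum blocks and the pair plane waves (stub `stub_twoHoleGapOrthogonal`)

Companion of `…TwoHoleGapSchur` / `…TwoHoleGapBlocks`. The blocks of the architecture theorem
`exists_gap_orthogonal_of_blocks_schur` are instantiated, still as linear algebra over `ℂⁿ`, for a
unitary representation `v ↦ U v` of the finite torus `(ℤ/nℤ)^d` (for the stub: the plaquette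
translations `U_{2v}` of the breathing `L × L` torus, `n = L`, acting through `(ℤ/(L/2)ℤ)²`) by
matrices commuting with the Hermitian `H` and preserving the sector `K`:

* the ISOTYPIC PROJECTIONS `Π_k = n^{-d} Σ_v conj χ_k(v) U_v` (`χ_k = torusChar k` the characters of
  the tree's `TorusFourierProofs`): Hermitian, `U_w Π_k = χ_k(w) Π_k`, `Π_k Π_{k'} = δ_{kk'} Π_k`,
  `Σ_k Π_k = 1`, commuting with `H`, preserving `K` — hence an `H`-decoupled orthogonal resolution of
  `K` (`isotypic_*`);
* the PLANE WAVES `p_k = Σ_m conj χ_k(m) U_m Ψ₀` of the translates of one vector `Ψ₀ ∈ K` (the dressed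
  pair state of the plaquette at the origin): `U_w p_k = χ_k(w) p_k`, `Π_{k'} p_k = δ_{kk'} p_k`, and
  the three scalars of the Schur inequality are Fourier transforms of translation-invariant kernels,
  `⟨p_k, A p_k⟩ = n^d Σ_a conj χ_k(a) ⟨Ψ₀, A U_a Ψ₀⟩` for every `A` commuting with the `U_v`
  (`A = 1, H, H²`; `planeWave_form_eq_sum`) — the explicit `(L/2)²`-dimensional translation-invariant
  effective data of the pair band;
* `exists_gap_orthogonal_of_translates` — the conclusion of the stub at one size from (E1) a gap
  above `E₁` on the momentum-`k` vectors of `K` orthogonal to `p_k`, for every `k`, and (E2) the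
  scalar Schur inequality of `p_k` for every `k ≠ k₀`, plus `Re⟨p_{k₀}, H p_{k₀}⟩ < E₁ ‖p_{k₀}‖²`.

References: J.-P. Serre, *Linear Representations of Finite Groups* (1977) §2.6 (canonical
decomposition, Thm. 8); H. Yao, W.-F. Tsai, S. A. Kivelson, PRB 76 (2007) 161104 (pair band of the
checkerboard Hubbard model). All statements are [folklore]; no definition is introduced (the
projections and plane waves enter through defining hypotheses `hPk`, `hp`).
-/

set_option linter.dupNamespace false -- the route namespace `HubbardSuperconductivity.HubbardSuperconductivity` is mandated

noncomputable section

namespace Summit.HubbardSuperconductivity.HubbardSuperconductivity.Theorems.CooperPairDMottWalk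

open Matrix Finset
open scoped ComplexOrder ComplexConjugate
open Literature.MathematicalPhysics.QuantumLattice Literature.Probability.LatticeModels
open Literature.MathematicalPhysics.QuantumLattice.EigenvalueContinuation (re_star_dotProduct_self_nonneg)

/-! ### Character sums -/

section Characters

variable {d n : ℕ} [NeZero n]

/-- Orthogonality of characters with a conjugate: `Σ_v conj χ_k(v) χ_{k'}(v) = n^d δ_{kk'}`. [folklore] -/
theorem sum_conj_torusChar_mul_torusChar (k k' : TorusSite d n) :
    ∑ v, conj (torusChar k v) * torusChar k' v = if k = k' then (n : ℂ) ^ d else 0 := by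
  have : ∀ v, conj (torusChar k v) * torusChar k' v = torusChar (k' - k) v := fun v => by
    rw [torusChar_sub_left, mul_comm]
  simp_rw [this, sum_torusChar_right, sub_eq_zero, eq_comm]

/-- Completeness of characters with a conjugate: `Σ_k conj χ_k(v) = n^d δ_{v0}`. [folklore] -/
theorem sum_conj_torusChar (v : TorusSite d n) :
    ∑ k, conj (torusChar k v) = if v = 0 then (n : ℂ) ^ d else 0 := by
  rw [← map_sum, sum_torusChar_left]
  split_ifs <;> simp

omit [NeZero n] in
/-- `conj (n^d)⁻¹ = (n^d)⁻¹`. [folklore] -/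
theorem conj_natCast_pow_inv : conj (((n : ℂ) ^ d)⁻¹) = ((n : ℂ) ^ d)⁻¹ := by
  rw [map_inv₀, map_pow, map_natCast]

end Characters

/-! ### Isotypic projections of a unitary representation of the torus group -/

section Isotypic

variable {ι : Type*} [Fintype ι] [DecidableEq ι] {d n : ℕ} [NeZero n]
  (U : TorusSite d n → Matrix ι ι ℂ) (Pk : TorusSite d n → Matrix ι ι ℂ)
  (hPk : ∀ k, Pk k = ((n : ℂ) ^ d)⁻¹ • ∑ v, conj (torusChar k v) • U v)

include hPk

omit [Fintype ι] [DecidableEq ι] in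
/-- **`Π_k` is Hermitian** when `(U_v)ᴴ = U_{-v}`. Serre §2.6. [folklore] -/
theorem isotypic_conjTranspose (hUstar : ∀ v, (U v)ᴴ = U (-v)) (k : TorusSite d n) : (Pk k)ᴴ = Pk k := by
  rw [hPk, conjTranspose_smul, conjTranspose_sum, Complex.star_def, conj_natCast_pow_inv]
  congr 1
  simp_rw [conjTranspose_smul, Complex.star_def, Complex.conj_conj, hUstar]
  rw [← Equiv.sum_comp (Equiv.neg (TorusSite d n))]
  refine Finset.sum_congr rfl fun v _ => ?_
  rw [Equiv.neg_apply, neg_neg, torusChar_neg_right]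

omit [DecidableEq ι] in
/-- **`U_w Π_k = χ_k(w) Π_k`**: the range of `Π_k` consists of `χ_k`-eigenvectors of the
representation. Serre §2.6. [folklore] -/
theorem mul_isotypic (hUadd : ∀ v w, U (v + w) = U v * U w) (w k : TorusSite d n) :
    U w * Pk k = torusChar k w • Pk k := by
  rw [hPk, mul_smul_comm, Finset.mul_sum, smul_comm]
  congr 1
  simp_rw [mul_smul_comm, ← hUadd]
  rw [← Equiv.sum_comp (Equiv.subRight w), Finset.smul_sum]
  refine Finset.sum_congr rfl fun u _ => ?_
  rw [Equiv.subRight_apply, add_sub_cancel, torusChar_sub_right, map_mul, Complex.conj_conj, smul_smul,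
    mul_comm]

omit [DecidableEq ι] in
/-- **`Π_k Π_{k'} = δ_{kk'} Π_k`**: the isotypic projections are orthogonal idempotents.
Serre §2.6, Thm. 8. [folklore] -/
theorem isotypic_mul_isotypic (hUadd : ∀ v w, U (v + w) = U v * U w) (k k' : TorusSite d n) :
    Pk k * Pk k' = if k = k' then Pk k else 0 := by
  conv_lhs => rw [hPk k]
  rw [smul_mul_assoc, Finset.sum_mul]
  simp_rw [smul_mul_assoc, mul_isotypic U Pk hPk hUadd _ k', smul_smul]
  rw [← Finset.sum_smul, sum_conj_torusChar_mul_torusChar]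
  split_ifs with h
  · subst h
    rw [smul_smul, inv_mul_cancel₀ natCast_pow_ne_zero, one_smul]
  · rw [zero_smul, smul_zero]

omit [Fintype ι] [DecidableEq ι] in
/-- **`Σ_k Π_k = U_0`** (`= 1` for a representation): the isotypic projections resolve the identity.
Serre §2.6, Thm. 8. [folklore] -/
theorem sum_isotypic : ∑ k, Pk k = U 0 := by
  simp_rw [hPk]
  rw [← Finset.smul_sum, Finset.sum_comm]
  simp_rw [← Finset.sum_smul, sum_conj_torusChar, ite_smul, zero_smul]
  rw [Finset.sum_ite_eq', if_pos (Finset.mem_univ _), smul_smul, inv_mul_cancel₀ natCast_pow_ne_zero, one_smul]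

omit [DecidableEq ι] in
/-- `Π_k` commutes with every operator commuting with the representation. [folklore] -/
theorem commute_isotypic {H : Matrix ι ι ℂ} (hUH : ∀ v, Commute (U v) H) (k : TorusSite d n) :
    Commute (Pk k) H := by
  rw [hPk]
  exact Commute.smul_left (Commute.sum_left _ _ _ fun v _ => Commute.smul_left (hUH v) _) _

omit [DecidableEq ι] in
/-- `Π_k` preserves every subspace preserved by the representation. [folklore] -/
theorem isotypic_mulVec_mem (K : Submodule ℂ (ι → ℂ)) (hUK : ∀ v, ∀ ψ ∈ K, U v *ᵥ ψ ∈ K)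
    (k : TorusSite d n) {ψ : ι → ℂ} (hψ : ψ ∈ K) : Pk k *ᵥ ψ ∈ K := by
  rw [hPk, smul_mulVec, sum_mulVec]
  refine K.smul_mem _ (K.sum_mem fun v _ => ?_)
  rw [smul_mulVec]
  exact K.smul_mem _ (hUK v ψ hψ)

omit [DecidableEq ι] in
/-- Vectors in the range of `Π_k` carry momentum `k`: `Π_k ψ = ψ ⟹ U_w ψ = χ_k(w) ψ`. [folklore] -/
theorem mulVec_eq_smul_of_isotypic_fix (hUadd : ∀ v w, U (v + w) = U v * U w) (k : TorusSite d n)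
    {ψ : ι → ℂ} (hψ : Pk k *ᵥ ψ = ψ) (w : TorusSite d n) : U w *ᵥ ψ = torusChar k w • ψ := by
  conv_lhs => rw [← hψ]
  rw [mulVec_mulVec, mul_isotypic U Pk hPk hUadd, smul_mulVec, hψ]

omit [DecidableEq ι] in
/-- **The isotypic projections are an `H`-decoupled orthogonal resolution** (the hypotheses
`hsum`, `hPK`, `hPP`, `horth`, `hblock` of `gap_orthogonal_of_blocks_schur`; `U_0` acts as the
identity). [folklore] -/
theorem isotypic_resolution (hU0 : ∀ ψ, U 0 *ᵥ ψ = ψ) (hUadd : ∀ v w, U (v + w) = U v * U w)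
    (hUstar : ∀ v, (U v)ᴴ = U (-v)) {H : Matrix ι ι ℂ} (hUH : ∀ v, Commute (U v) H)
    (K : Submodule ℂ (ι → ℂ)) (hUK : ∀ v, ∀ ψ ∈ K, U v *ᵥ ψ ∈ K) :
    (∀ ψ ∈ K, ∑ k, Pk k *ᵥ ψ = ψ) ∧ (∀ k, ∀ ψ ∈ K, Pk k *ᵥ ψ ∈ K) ∧
      (∀ k, ∀ ψ ∈ K, Pk k *ᵥ (Pk k *ᵥ ψ) = Pk k *ᵥ ψ) ∧
      (∀ i j, i ≠ j → ∀ ψ ∈ K, ∀ ψ' ∈ K, star (Pk i *ᵥ ψ) ⬝ᵥ (Pk j *ᵥ ψ') = 0) ∧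
      (∀ i j, i ≠ j → ∀ ψ ∈ K, star (Pk i *ᵥ ψ) ⬝ᵥ (H *ᵥ (Pk j *ᵥ ψ)) = 0) := by
  classical
  have hherm : ∀ i (u w : ι → ℂ), star (Pk i *ᵥ u) ⬝ᵥ w = star u ⬝ᵥ (Pk i *ᵥ w) := fun i u w => by
    rw [star_mulVec, isotypic_conjTranspose U Pk hPk hUstar, dotProduct_mulVec]
  refine ⟨fun ψ _ => ?_, fun k ψ hψ => isotypic_mulVec_mem U Pk hPk K hUK k hψ, fun k ψ _ => ?_,
    fun i j hij ψ _ ψ' _ => ?_, fun i j hij ψ _ => ?_⟩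
  · rw [← sum_mulVec, sum_isotypic U Pk hPk, hU0]
  · rw [mulVec_mulVec, isotypic_mul_isotypic U Pk hPk hUadd, if_pos rfl]
  · rw [hherm, mulVec_mulVec, isotypic_mul_isotypic U Pk hPk hUadd, if_neg hij, zero_mulVec, dotProduct_zero]
  · rw [hherm, mulVec_mulVec, mulVec_mulVec, (commute_isotypic U Pk hPk hUH i).eq, Matrix.mul_assoc,
      isotypic_mul_isotypic U Pk hPk hUadd, if_neg hij, Matrix.mul_zero, zero_mulVec, dotProduct_zero]

end Isotypic

/-! ### Plane waves of the translates of one vector -/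

section PlaneWaves

variable {ι : Type*} [Fintype ι] [DecidableEq ι] {d n : ℕ} [NeZero n]
  (U : TorusSite d n → Matrix ι ι ℂ) (Ψ₀ : ι → ℂ) (p : TorusSite d n → ι → ℂ)
  (hp : ∀ k, p k = ∑ m, conj (torusChar k m) • (U m *ᵥ Ψ₀))

include hp

omit [DecidableEq ι] in
/-- **Plane waves carry momentum**: `U_w p_k = χ_k(w) p_k`. [folklore] -/
theorem mulVec_planeWave (hUadd : ∀ v w, U (v + w) = U v * U w) (w k : TorusSite d n) :
    U w *ᵥ p k = torusChar k w • p k := by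
  rw [hp, mulVec_sum, Finset.smul_sum]
  simp_rw [mulVec_smul, mulVec_mulVec, ← hUadd]
  rw [← Equiv.sum_comp (Equiv.subRight w)]
  refine Finset.sum_congr rfl fun u _ => ?_
  rw [Equiv.subRight_apply, add_sub_cancel, torusChar_sub_right, map_mul, Complex.conj_conj, smul_smul,
    mul_comm]

omit [DecidableEq ι] in
/-- **Plane waves are sorted by the isotypic projections**: `Π_{k'} p_k = δ_{kk'} p_k`. [folklore] -/
theorem isotypic_mulVec_planeWave (hUadd : ∀ v w, U (v + w) = U v * U w)
    (Pk : TorusSite d n → Matrix ι ι ℂ) (hPk : ∀ k, Pk k = ((n : ℂ) ^ d)⁻¹ • ∑ v, conj (torusChar k v) • U v)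
    (k' k : TorusSite d n) : Pk k' *ᵥ p k = if k' = k then p k else 0 := by
  rw [hPk, smul_mulVec, sum_mulVec]
  simp_rw [smul_mulVec, mulVec_planeWave U Ψ₀ p hp hUadd, smul_smul]
  rw [← Finset.sum_smul, sum_conj_torusChar_mul_torusChar]
  split_ifs with h
  · rw [smul_smul, inv_mul_cancel₀ natCast_pow_ne_zero, one_smul]
  · rw [zero_smul, smul_zero]

omit [DecidableEq ι] in
/-- Plane waves of translates inside an invariant subspace stay inside. [folklore] -/
theorem planeWave_mem (K : Submodule ℂ (ι → ℂ)) (hUK : ∀ v, ∀ ψ ∈ K, U v *ᵥ ψ ∈ K) (hΨ₀ : Ψ₀ ∈ K)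
    (k : TorusSite d n) : p k ∈ K := by
  rw [hp]
  exact K.sum_mem fun m _ => K.smul_mem _ (hUK m Ψ₀ hΨ₀)

omit [DecidableEq ι] in
/-- **The Schur scalars of a plane wave are Fourier transforms of translation-invariant kernels.**
For every `A` commuting with the (unitary) representation,
`⟨p_k, A p_k⟩ = n^d Σ_a conj χ_k(a) ⟨Ψ₀, A U_a Ψ₀⟩`; with `A = 1, H, H²` these are `‖p_k‖²`,
`⟨p_k, H p_k⟩`, `‖H p_k‖²`. (The kernel `a ↦ ⟨Ψ₀, A U_a Ψ₀⟩` is the explicit translation-invariant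
effective matrix of the pair band in the basis of translates of `Ψ₀`.) [folklore] -/
theorem planeWave_form_eq_sum (hUadd : ∀ v w, U (v + w) = U v * U w)
    (hUstar : ∀ v, (U v)ᴴ = U (-v)) {A : Matrix ι ι ℂ} (hUA : ∀ v, Commute (U v) A) (k : TorusSite d n) :
    star (p k) ⬝ᵥ (A *ᵥ p k) = (n : ℂ) ^ d * ∑ a, conj (torusChar k a) * (star Ψ₀ ⬝ᵥ (A *ᵥ (U a *ᵥ Ψ₀))) := by
  -- the translation-invariant kernel
  have hker : ∀ m m', star (U m' *ᵥ Ψ₀) ⬝ᵥ (A *ᵥ (U m *ᵥ Ψ₀)) = star Ψ₀ ⬝ᵥ (A *ᵥ (U (m - m') *ᵥ Ψ₀)) := by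
    intro m m'
    have h1 : U (-m') *ᵥ (U m *ᵥ Ψ₀) = U (m - m') *ᵥ Ψ₀ := by
      rw [mulVec_mulVec, ← hUadd, neg_add_eq_sub]
    have h2 : ∀ x, U (-m') *ᵥ (A *ᵥ x) = A *ᵥ (U (-m') *ᵥ x) := fun x => by
      rw [mulVec_mulVec, (hUA _).eq, ← mulVec_mulVec]
    rw [star_mulVec, hUstar, ← dotProduct_mulVec, h2, h1]
  have hone : ∀ m', conj (torusChar k m') * torusChar k m' = 1 := fun m' => by
    rw [mul_comm, torusChar_mul_conj]
  rw [hp, star_sum, sum_dotProduct, mulVec_sum]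
  -- rewrite the double sum with the kernel and reindex the inner sum by the difference
  have hinner : ∀ m', star (conj (torusChar k m') • (U m' *ᵥ Ψ₀)) ⬝ᵥ
      (∑ m, A *ᵥ (conj (torusChar k m) • (U m *ᵥ Ψ₀))) =
        ∑ a, conj (torusChar k a) * (star Ψ₀ ⬝ᵥ (A *ᵥ (U a *ᵥ Ψ₀))) := by
    intro m'
    rw [dotProduct_sum, ← Equiv.sum_comp (Equiv.addRight m')]
    refine Finset.sum_congr rfl fun a _ => ?_
    rw [Equiv.coe_addRight, mulVec_smul, dotProduct_smul, star_smul, smul_dotProduct, hker, add_sub_cancel_right,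
      smul_eq_mul, smul_eq_mul, Complex.star_def, Complex.conj_conj, torusChar_add_right, map_mul]
    linear_combination (conj (torusChar k a) * (star Ψ₀ ⬝ᵥ (A *ᵥ (U a *ᵥ Ψ₀)))) * hone m'
  simp_rw [hinner]
  rw [Finset.sum_const, Finset.card_univ, nsmul_eq_mul, Fintype.card_fun, ZMod.card, Fintype.card_fin]
  push_cast
  rfl

end PlaneWaves

/-! ### The conclusion of the stub from one dressed pair state and its plane waves -/

section Translates

variable {ι : Type*} [Fintype ι] [DecidableEq ι] {d n : ℕ} [NeZero n]

omit [DecidableEq ι] in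
/-- **Gap above the bottom plane wave from (E1) and (E2).** Let `H` be Hermitian, `v ↦ U v` a
unitary representation of `(ℤ/nℤ)^d` (`U_0` acting as the identity) commuting with `H` and preserving the subspace `K`, `Ψ₀ ∈ K`
(the dressed pair state of the block at the origin) with plane waves
`p_k = Σ_m conj χ_k(m) U_m Ψ₀`, `k₀` a momentum and `E₁` a level with
`Re⟨p_{k₀}, H p_{k₀}⟩ < E₁ ‖p_{k₀}‖²`. Suppose
(E1) for every momentum `k`: `(E₁ + g k) ‖ψ‖² ≤ Re⟨ψ, Hψ⟩` for all `ψ ∈ K` of momentum `k`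
  (`U_w ψ = χ_k(w) ψ`) orthogonal to `p_k`, with `g k > 0` (the complement / two-holon threshold);
(E2) for every `k ≠ k₀` the scalar Schur inequality
  `‖H p_k‖² ‖p_k‖² − ⟨p_k, H p_k⟩² ≤ (⟨p_k, H p_k⟩ − E₁ ‖p_k‖²) · g k · ‖p_k‖²`
  (pair-band dispersion above the level, leakage absorbed; its three scalars are the Fourier
  transforms `planeWave_form_eq_sum` of the kernels `⟨Ψ₀, A U_a Ψ₀⟩`, `A = 1, H, H²`).
Then `∃ Ω E, minEnergyOn H K < E ∧ (H ≥ E on Ω^⊥ ∩ K)` (`Ω = p_{k₀}`, `E = E₁`): the conclusion of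
`stub_twoHoleGapOrthogonal` at one size. [folklore] -/
theorem exists_gap_orthogonal_of_translates (H : Matrix ι ι ℂ) (hH : H.IsHermitian)
    (K : Submodule ℂ (ι → ℂ)) (U : TorusSite d n → Matrix ι ι ℂ) (hU0 : ∀ ψ, U 0 *ᵥ ψ = ψ)
    (hUadd : ∀ v w, U (v + w) = U v * U w) (hUstar : ∀ v, (U v)ᴴ = U (-v))
    (hUH : ∀ v, Commute (U v) H) (hUK : ∀ v, ∀ ψ ∈ K, U v *ᵥ ψ ∈ K) {Ψ₀ : ι → ℂ} (hΨ₀ : Ψ₀ ∈ K)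
    (p : TorusSite d n → ι → ℂ) (hp : ∀ k, p k = ∑ m, conj (torusChar k m) • (U m *ᵥ Ψ₀))
    (k₀ : TorusSite d n) (E₁ : ℝ) (g : TorusSite d n → ℝ) (hg : ∀ k, 0 < g k)
    (hlt : (star (p k₀) ⬝ᵥ H *ᵥ p k₀).re < E₁ * (star (p k₀) ⬝ᵥ p k₀).re)
    (hE1 : ∀ k, ∀ ψ ∈ K, (∀ w, U w *ᵥ ψ = torusChar k w • ψ) → star (p k) ⬝ᵥ ψ = 0 →
      (E₁ + g k) * (star ψ ⬝ᵥ ψ).re ≤ (star ψ ⬝ᵥ H *ᵥ ψ).re)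
    (hE2 : ∀ k, k ≠ k₀ →
      (star (H *ᵥ p k) ⬝ᵥ (H *ᵥ p k)).re * (star (p k) ⬝ᵥ p k).re - (star (p k) ⬝ᵥ H *ᵥ p k).re ^ 2 ≤
        ((star (p k) ⬝ᵥ H *ᵥ p k).re - E₁ * (star (p k) ⬝ᵥ p k).re) * g k * (star (p k) ⬝ᵥ p k).re) :
    ∃ (Ω : ι → ℂ) (E : ℝ), H.minEnergyOn K < E ∧
      ∀ ψ ∈ K, star Ω ⬝ᵥ ψ = 0 → E * (star ψ ⬝ᵥ ψ).re ≤ (star ψ ⬝ᵥ H *ᵥ ψ).re := by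
  set Pk : TorusSite d n → Matrix ι ι ℂ := fun k => ((n : ℂ) ^ d)⁻¹ • ∑ v, conj (torusChar k v) • U v
    with hPk'
  have hPk : ∀ k, Pk k = ((n : ℂ) ^ d)⁻¹ • ∑ v, conj (torusChar k v) • U v := fun k => rfl
  obtain ⟨hsum, hPK, hPP, horth, hblock⟩ := isotypic_resolution U Pk hPk hU0 hUadd hUstar hUH K hUK
  refine exists_gap_orthogonal_of_blocks_schur H hH K Pk k₀ p E₁ g hg hsum hPK hPP horth hblock
    (fun k => ⟨p k, planeWave_mem U Ψ₀ p hp K hUK hΨ₀ k, ?_⟩) hlt (fun k ψ hψ h0 => ?_) hE2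
  · rw [isotypic_mulVec_planeWave U Ψ₀ p hp hUadd Pk hPk, if_pos rfl]
  · exact hE1 k (Pk k *ᵥ ψ) (hPK k ψ hψ) (mulVec_eq_smul_of_isotypic_fix U Pk hPk hUadd k (hPP k ψ hψ)) h0

/-! ### Registered form -/

/-- **Registered sub-goal `twoHoleGap_momentumSchur`** (closed form, as registered on the crux item):
`exists_gap_orthogonal_of_translates`. [folklore] -/
theorem twoHoleGap_momentumSchur : ∀ {ι : Type} [Fintype ι] {d n : ℕ} [NeZero n] (H : Matrix ι ι ℂ), H.IsHermitian → ∀ (K : Submodule ℂ (ι → ℂ)) (U : Literature.Probability.LatticeModels.TorusSite d n → Matrix ι ι ℂ), (∀ ψ, U 0 *ᵥ ψ = ψ) → (∀ v w, U (v + w) = U v * U w) → (∀ v, (U v)ᴴ = U (-v)) → (∀ v, Commute (U v) H) → (∀ v, ∀ ψ ∈ K, U v *ᵥ ψ ∈ K) → ∀ {Ψ₀ : ι → ℂ}, Ψ₀ ∈ K → ∀ (p : Literature.Probability.LatticeModels.TorusSite d n → ι → ℂ), (∀ k, p k = ∑ m, starRingEnd ℂ (Literature.Probability.LatticeModels.torusChar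 k m) • (U m *ᵥ Ψ₀)) → ∀ (k₀ : Literature.Probability.LatticeModels.TorusSite d n) (E₁ : ℝ) (g : Literature.Probability.LatticeModels.TorusSite d n → ℝ), (∀ k, 0 < g k) → (star (p k₀) ⬝ᵥ H *ᵥ p k₀).re < E₁ * (star (p k₀) ⬝ᵥ p k₀).re → (∀ k, ∀ ψ ∈ K, (∀ w, U w *ᵥ ψ = Literature.Probability.LatticeModels.torusChar k w • ψ) → star (p k) ⬝ᵥ ψ = 0 → (E₁ + g k) * (star ψ ⬝ᵥ ψ).re ≤ (star ψ ⬝ᵥ H *ᵥ ψ).re) → (∀ k, k ≠ k₀ → (star (H *ᵥ p k) ⬝ᵥ (H *ᵥ p k)).re * (star (p k) ⬝ᵥ p k).re - (star (p k) ⬝ᵥ H *ᵥ p k).re ^ 2 ≤ ((star (p k) ⬝ᵥ H *ᵥ p k).re - E₁ * (star (p k) ⬝ᵥ p k).re) * g k * (star (p k) ⬝ᵥ p k).re) → ∃ (Ω : ι → ℂ) (E : ℝ), H.minEnergyOn K < E ∧ ∀ ψ ∈ K, star Ω ⬝ᵥ ψ = 0 → E * (star ψ ⬝ᵥ ψ).re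 ≤ (star ψ ⬝ᵥ H *ᵥ ψ).re :=
  fun H hH K U hU0 hUadd hUstar hUH hUK _ hΨ₀ p hp k₀ E₁ g hg hlt hE1 hE2 =>
    exists_gap_orthogonal_of_translates H hH K U hU0 hUadd hUstar hUH hUK hΨ₀ p hp k₀ E₁ g hg hlt hE1 hE2

end Translates

end Summit.HubbardSuperconductivity.HubbardSuperconductivity.Theorems.CooperPairDMottWalk

end
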